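import Mathlib.Data.ENat.Lattice
import Mathlib.GroupTheory.Index
import Mathlib.InformationTheory.Hamming
import Mathlib.LinearAlgebra.Basis.VectorSpace
import Mathlib.LinearAlgebra.Matrix.ToLin
import Mathlib.LinearAlgebra.Pi
import Mathlib.LinearAlgebra.SesquilinearForm.Orthogonal
import Mathlib.Probability.Distributions.Uniform
import HarnessLib

/-!
# Linear codes: minimum distance, dual code, dual distance, and `(d-1)`-wise independence of
the uniform distribution on a code of dual distance `d`

A *linear code* of length `ι` over a field `F` is a subspace `C ≤ F^ι` (Mathlib's
`Submodule F (ι → F)`; Hamming weight/distance are Mathlib's `hammingNorm`/`hammingDist` of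
`Mathlib/InformationTheory/Hamming.lean`). This file adds the three standard parameters that
Mathlib lacks (searched: `minDist`, `dualDist`, `LinearCode`, `dual distance` — nothing in
Mathlib or the tree) and proves the one fact about them used by the barrier entry
`Literature/Barriers/PneNP/LowDegreeCounterexamples.lean` (Holmgren–Wein 2021, Thm. 2):

* `minDist C : ℕ∞` — the minimum Hamming weight of a nonzero codeword (`⊤` for the zero code);
* `dualCode C` — the dual code `C⊥ = {y | ⟨c, y⟩ = 0 ∀ c ∈ C}`; this is Mathlib's orthogonal
  `Submodule.orthogonalBilin` for the dot-product form `dotProductBilin F F` (not redefined);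
* `dualDist C = minDist (dualCode C)` — the dual distance (Holmgren–Wein Def. 3 / LIPIcs Def. 8);
* `uniformOn C : PMF (ι → F)` — the uniform distribution on the codewords;
* **Prop. 1** (`uniformOn_map_restrict`): if `|S| < dualDist C` then the marginal of
  `uniformOn C` on the coordinates `S` is uniform on `F^S` — "if `C` is a linear code with dual
  distance `d`, then the uniform distribution over codewords is `(d-1)`-wise independent"
  (Holmgren–Wein 2021, Prop. 1 = LIPIcs Prop. 9, proof printed there: the columns of a generator
  matrix indexed by `S` are linearly independent, else a dependency is a dual codeword of weight
  `≤ |S| < d`; we run the same argument dually — if the restriction map `C → F^S` is not onto, a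
  nonzero functional vanishing on its image (`Submodule.exists_le_ker_of_lt_top`) extends by zero
  to a nonzero dual codeword supported in `S`), together with the group-theoretic fact that a
  surjective homomorphism of finite groups pushes the uniform distribution forward to the uniform
  distribution (`map_uniformOfFintype_of_surjective`, fibres = cosets of the kernel, via Mathlib's
  `AddMonoidHom.card_fiber_eq_of_mem_range`).

## References

* J. Holmgren, A. S. Wein, *Counterexamples to the low-degree conjecture*, ITCS 2021
  (LIPIcs 185:75) = arXiv:2004.08454, §4: Def. 3, Prop. 1 (arXiv PDF p. 7) = Def. 8, Prop. 9
  (LIPIcs p. 75:5). Held (`lit read doi-10-4230-lipics-itcs-2021-75 --pages 5`).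
* F. J. MacWilliams, N. J. A. Sloane, *The Theory of Error-Correcting Codes* (1977), Ch. 1 §8
  (dual code), Ch. 5 §5 Thm. 8 (codewords of a code with dual distance `d'` form an orthogonal
  array of strength `d' - 1`) — the classical source of Prop. 1; not held, cited through
  Holmgren–Wein.
-/

noncomputable section

namespace Literature.InformationTheory.Coding

open Matrix Finset
open scoped ENNReal

variable {F : Type*} [Field F] [DecidableEq F] {ι : Type*} [Fintype ι] [DecidableEq ι]

/-! ### Minimum distance, dual code, dual distance -/

/-- The **minimum distance** of a linear code `C ≤ F^ι`: the least Hamming weight of a nonzero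
codeword, as an extended natural number (`⊤` when `C = 0` has no nonzero codeword). For a linear
code this is the least Hamming distance between two distinct codewords.
[cite: HolmgrenWein2021, §4 (arXiv p. 7; LIPIcs p. 75:5: "the distance of C is ... the minimum Hamming weight of a nonzero codeword")] -/
def minDist (C : Submodule F (ι → F)) : ℕ∞ :=
  ⨅ (c : ι → F) (_ : c ∈ C) (_ : c ≠ 0), (hammingNorm c : ℕ∞)

/-- The **dual code** `C⊥ = {y ∈ F^ι | ⟨c, y⟩ = 0 for all c ∈ C}`: Mathlib's orthogonal submodule
of `C` for the dot-product bilinear form. [cite: HolmgrenWein2021, Def. 3 (arXiv p. 7; LIPIcs Def. 8)] -/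
def dualCode (C : Submodule F (ι → F)) : Submodule F (ι → F) :=
  C.orthogonalBilin (dotProductBilin F F)

/-- The **dual distance** of `C`: the minimum distance of the dual code, i.e. the least Hamming
weight of a nonzero vector orthogonal to all codewords.
[cite: HolmgrenWein2021, Def. 3 (arXiv p. 7; LIPIcs Def. 8)] -/
def dualDist (C : Submodule F (ι → F)) : ℕ∞ :=
  minDist (dualCode C)

omit [DecidableEq ι] in
/-- `d ≤ minDist C` iff every nonzero codeword has weight `≥ d`. [folklore] -/
theorem le_minDist_iff {C : Submodule F (ι → F)} {d : ℕ∞} :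
    d ≤ minDist C ↔ ∀ c ∈ C, c ≠ 0 → d ≤ hammingNorm c := by
  simp [minDist, le_iInf_iff]

omit [DecidableEq ι] in
/-- A nonzero codeword bounds the minimum distance. [folklore] -/
theorem minDist_le_hammingNorm {C : Submodule F (ι → F)} {c : ι → F} (hc : c ∈ C) (h0 : c ≠ 0) :
    minDist C ≤ hammingNorm c :=
  le_minDist_iff.1 le_rfl c hc h0

omit [DecidableEq ι] in
/-- The zero code has minimum distance `⊤`. [folklore] -/
@[simp] theorem minDist_bot : minDist (⊥ : Submodule F (ι → F)) = ⊤ :=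
  top_le_iff.1 (le_minDist_iff.2 fun _ hc h0 => (h0 ((Submodule.mem_bot F).1 hc)).elim)

omit [DecidableEq F] [DecidableEq ι] in
/-- Membership in the dual code: `y ∈ C⊥ ↔ ⟨c, y⟩ = 0` for all `c ∈ C`.
[cite: HolmgrenWein2021, Def. 3 (arXiv p. 7; LIPIcs Def. 8)] -/
theorem mem_dualCode_iff {C : Submodule F (ι → F)} {y : ι → F} :
    y ∈ dualCode C ↔ ∀ c ∈ C, c ⬝ᵥ y = 0 := by
  simp [dualCode, Submodule.mem_orthogonalBilin_iff]

omit [DecidableEq ι] in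
/-- `d ≤ dualDist C` iff every nonzero vector orthogonal to `C` has weight `≥ d`. [folklore] -/
theorem le_dualDist_iff {C : Submodule F (ι → F)} {d : ℕ∞} :
    d ≤ dualDist C ↔ ∀ y : ι → F, (∀ c ∈ C, c ⬝ᵥ y = 0) → y ≠ 0 → d ≤ hammingNorm y := by
  simp only [dualDist, le_minDist_iff, mem_dualCode_iff]

omit [DecidableEq ι] in
/-- `k < dualDist C` (for a natural number `k`) iff every nonzero vector orthogonal to `C` has
weight `> k`. [folklore] -/
theorem natCast_lt_dualDist_iff {C : Submodule F (ι → F)} {k : ℕ} :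
    (k : ℕ∞) < dualDist C ↔ ∀ y : ι → F, (∀ c ∈ C, c ⬝ᵥ y = 0) → y ≠ 0 → k < hammingNorm y := by
  rw [← ENat.add_one_le_iff (ENat.coe_ne_top k), le_dualDist_iff]
  refine forall₃_congr fun y _ _ => ?_
  rw [← Nat.cast_one, ← Nat.cast_add, Nat.cast_le, Nat.add_one_le_iff]

omit [DecidableEq ι] in
/-- A nonzero dual codeword bounds the dual distance. [folklore] -/
theorem dualDist_le_hammingNorm {C : Submodule F (ι → F)} {y : ι → F} (hy : ∀ c ∈ C, c ⬝ᵥ y = 0)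
    (h0 : y ≠ 0) : dualDist C ≤ hammingNorm y :=
  minDist_le_hammingNorm (mem_dualCode_iff.2 hy) h0

/-! ### The uniform distribution on a code -/

section Uniform

variable [Fintype F]

open scoped Classical in
/-- The **uniform distribution on the codewords** of `C` (a nonempty finite set: it contains `0`).
[cite: HolmgrenWein2021, Prop. 1 (arXiv p. 7; LIPIcs Prop. 9: "the uniform distribution over codewords")] -/
def uniformOn (C : Submodule F (ι → F)) : PMF (ι → F) :=
  PMF.uniformOfFinset (C : Set (ι → F)).toFinset ⟨0, by simp⟩

omit [DecidableEq F] in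
open scoped Classical in
/-- The uniform distribution on `C` gives mass `1 / |C|` to each codeword and `0` elsewhere.
[folklore] -/
theorem uniformOn_apply (C : Submodule F (ι → F)) (x : ι → F) :
    uniformOn C x = if x ∈ C then ((Nat.card C : ℝ≥0∞))⁻¹ else 0 := by
  classical
  have hcard : Nat.card C = #(C : Set (ι → F)).toFinset := by
    rw [← Nat.card_eq_card_toFinset]; rfl
  rw [uniformOn, PMF.uniformOfFinset_apply, hcard]
  simp only [Set.mem_toFinset, SetLike.mem_coe]

omit [DecidableEq F] in
/-- The support of `uniformOn C` is `C`. [folklore] -/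
@[simp] theorem support_uniformOn (C : Submodule F (ι → F)) :
    (uniformOn C).support = (C : Set (ι → F)) := by
  classical
  rw [uniformOn, PMF.support_uniformOfFinset, Set.coe_toFinset]

omit [DecidableEq F] in
/-- `x` is in the support of `uniformOn C` iff `x ∈ C`. [folklore] -/
theorem mem_support_uniformOn_iff (C : Submodule F (ι → F)) (x : ι → F) :
    x ∈ (uniformOn C).support ↔ x ∈ C := by
  rw [support_uniformOn, SetLike.mem_coe]

omit [DecidableEq F] in
/-- `uniformOn C` is the push-forward of the uniform distribution on the finite type `C` along the
inclusion. [folklore] -/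
theorem uniformOn_eq_map_subtype (C : Submodule F (ι → F)) [Fintype C] :
    uniformOn C = (PMF.uniformOfFintype C).map C.subtype := by
  classical
  ext x
  rw [uniformOn_apply, PMF.map_apply, tsum_fintype, Nat.card_eq_fintype_card]
  split_ifs with hx
  · rw [Finset.sum_eq_single ⟨x, hx⟩]
    · simp
    · rintro ⟨b, hb⟩ _ hne
      rw [if_neg]
      exact fun h => hne (Subtype.ext h.symm)
    · exact fun h => (h (mem_univ _)).elim
  · refine (Finset.sum_eq_zero fun c _ => if_neg ?_).symm
    rintro rfl
    exact hx c.2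

/-- **A surjective homomorphism of finite groups maps the uniform distribution to the uniform
distribution** (all fibres are cosets of the kernel, of equal size). [folklore] -/
theorem map_uniformOfFintype_of_surjective {G H Φ : Type*} [AddGroup G] [Fintype G] [Nonempty G]
    [AddGroup H] [Fintype H] [Nonempty H] [DecidableEq H] [FunLike Φ G H] [AddMonoidHomClass Φ G H]
    (φ : Φ) (hφ : Function.Surjective φ) :
    (PMF.uniformOfFintype G).map φ = PMF.uniformOfFintype H := by
  classical
  ext y
  rw [PMF.map_apply, tsum_fintype, PMF.uniformOfFintype_apply]
  simp_rw [PMF.uniformOfFintype_apply]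
  rw [← Finset.sum_filter, sum_const, nsmul_eq_mul]
  -- all fibres have the cardinality of the fibre over `y`
  have hfib : ∀ y' : H, #{g : G | φ g = y'} = #{g : G | φ g = y} := fun y' =>
    AddMonoidHom.card_fiber_eq_of_mem_range φ (hφ y') (hφ y)
  have hcard : Fintype.card G = Fintype.card H * #{g : G | φ g = y} := by
    rw [← Finset.card_univ, Finset.card_eq_sum_card_fiberwise (f := φ) (t := univ)
      (fun g _ => mem_univ (φ g))]
    simp_rw [hfib, sum_const, smul_eq_mul, Finset.card_univ]
  have hfilter : (univ.filter fun g : G => y = φ g) = univ.filter fun g : G => φ g = y := by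
    ext g; simp [eq_comm]
  rw [hfilter, hcard, Nat.cast_mul]
  set A : ℕ := Fintype.card H
  set B : ℕ := #{g : G | φ g = y}
  have hA0 : (A : ℝ≥0∞) ≠ 0 := by exact_mod_cast Fintype.card_ne_zero
  have hB0 : (B : ℝ≥0∞) ≠ 0 := by
    obtain ⟨g, hg⟩ := hφ y
    have : 0 < B := card_pos.2 ⟨g, by simpa using hg⟩
    exact_mod_cast this.ne'
  rw [ENNReal.mul_inv (Or.inl hA0) (Or.inl (ENNReal.natCast_ne_top A)), mul_comm (B : ℝ≥0∞),
    mul_assoc, ENNReal.inv_mul_cancel hB0 (ENNReal.natCast_ne_top B), mul_one]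

/-- **A bijection of finite types maps the uniform distribution to the uniform distribution.**
[folklore] -/
theorem map_uniformOfFintype_of_bijective {α β : Type*} [Fintype α] [Nonempty α] [Fintype β]
    [Nonempty β] (f : α → β) (hf : Function.Bijective f) :
    (PMF.uniformOfFintype α).map f = PMF.uniformOfFintype β := by
  classical
  ext y
  rw [PMF.map_apply, tsum_fintype, PMF.uniformOfFintype_apply]
  simp_rw [PMF.uniformOfFintype_apply]
  obtain ⟨x, rfl⟩ := hf.2 y
  rw [Finset.sum_eq_single x, if_pos rfl, Fintype.card_of_bijective hf]
  · intro b _ hb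
    rw [if_neg]
    exact fun h => hb (hf.1 h.symm)
  · exact fun h => (h (mem_univ x)).elim

end Uniform

/-! ### Prop. 1: dual distance `d` gives `(d-1)`-wise independence -/

omit [DecidableEq F] in
/-- The dot product with a vector extended by zero off `S` only sees the coordinates in `S`:
`⟨c, ext_S e⟩ = ⟨c|_S, e⟩`. [folklore] -/
theorem dotProduct_extend_by_zero (S : Finset ι) (e : S → F) (c : ι → F) :
    c ⬝ᵥ (fun i => if h : i ∈ S then e ⟨i, h⟩ else 0) = S.restrict c ⬝ᵥ e := by
  unfold dotProduct
  rw [← Finset.sum_subset (subset_univ S) fun i _ hi => by simp [hi], ← Finset.sum_attach]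
  refine sum_congr rfl fun i _ => ?_
  simp [Finset.restrict, i.2]

/-- **Restriction to fewer than `dualDist C` coordinates is onto** (the heart of Prop. 1): if
`|S| < dualDist C` then every pattern `y ∈ F^S` is the restriction of a codeword. Otherwise the
image of `C` in `F^S` is a proper subspace, killed by a nonzero functional `x ↦ ⟨x, e⟩`; extending
`e` by zero gives a nonzero dual codeword of weight `≤ |S|`.
[cite: HolmgrenWein2021, Prop. 1, proof (arXiv p. 7; LIPIcs Prop. 9, p. 75:5)] -/
theorem restrict_surjOn_of_card_lt_dualDist (C : Submodule F (ι → F)) (S : Finset ι)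
    (hS : (S.card : ℕ∞) < dualDist C) (y : S → F) : ∃ c ∈ C, S.restrict c = y := by
  classical
  -- the restriction as a linear map and the image of `C`
  let ρ : (ι → F) →ₗ[F] (S → F) := LinearMap.funLeft F F ((↑) : S → ι)
  have hρ : ∀ c, ρ c = S.restrict c := fun c => rfl
  by_contra hy
  push Not at hy
  have hlt : C.map ρ < ⊤ := by
    refine lt_top_iff_ne_top.2 fun htop => ?_
    have : y ∈ C.map ρ := htop ▸ Submodule.mem_top
    obtain ⟨c, hc, hcy⟩ := Submodule.mem_map.1 this
    exact hy c hc (hρ c ▸ hcy)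
  obtain ⟨f, hf0, hker⟩ := (C.map ρ).exists_le_ker_of_lt_top hlt
  -- `f x = ⟨x, e⟩` for the vector `e` of values of `f` on the coordinate vectors
  let e : S → F := fun i => f fun j => if i = j then 1 else 0
  have hfe : ∀ x : S → F, f x = x ⬝ᵥ e := fun x => by
    rw [LinearMap.pi_apply_eq_sum_univ f x]
    rfl
  -- extend `e` by zero to a dual codeword
  let z : ι → F := fun i => if h : i ∈ S then e ⟨i, h⟩ else 0
  have hzdual : ∀ c ∈ C, c ⬝ᵥ z = 0 := fun c hc => by
    rw [dotProduct_extend_by_zero, ← hfe]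
    exact LinearMap.mem_ker.1 (hker (Submodule.mem_map_of_mem hc))
  have hz0 : z ≠ 0 := by
    intro hz
    apply hf0
    refine LinearMap.ext fun x => ?_
    have he : e = 0 := by
      funext i
      have := congr_fun hz i
      simpa [z, i.2] using this
    rw [hfe, he, dotProduct_zero, LinearMap.zero_apply]
  have hwt : hammingNorm z ≤ S.card := by
    refine card_le_card fun i hi => ?_
    by_contra his
    simp [z, his] at hi
  have h1 : dualDist C ≤ hammingNorm z := dualDist_le_hammingNorm hzdual hz0
  have h2 : (hammingNorm z : ℕ∞) ≤ S.card := by exact_mod_cast hwt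
  exact lt_irrefl _ ((h1.trans h2).trans_lt hS)

/-- **Holmgren–Wein 2021, Prop. 1 (= LIPIcs Prop. 9): "If `C` is a linear code with dual distance
`d`, then the uniform distribution over codewords is `(d-1)`-wise independent with respect to
the uniform distribution on `Fⁿ`."** Precisely: for every set `S` of fewer than `dualDist C`
coordinates, the marginal of `uniformOn C` on `S` (push-forward along Mathlib's `Finset.restrict`)
is the uniform distribution on `F^S`. Proof: the restriction `C → F^S` is a surjective group
homomorphism (`restrict_surjOn_of_card_lt_dualDist`), and surjective homomorphisms of finite
groups preserve uniform distributions (`map_uniformOfFintype_of_surjective`).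
[cite: HolmgrenWein2021, Prop. 1 (arXiv p. 7; LIPIcs Prop. 9, p. 75:5)] -/
theorem uniformOn_map_restrict [Fintype F] (C : Submodule F (ι → F)) (S : Finset ι)
    (hS : (S.card : ℕ∞) < dualDist C) :
    (uniformOn C).map S.restrict = PMF.uniformOfFintype (S → F) := by
  classical
  let ρ : (ι → F) →ₗ[F] (S → F) := LinearMap.funLeft F F ((↑) : S → ι)
  let φ : C →ₗ[F] (S → F) := ρ.domRestrict C
  have hφ : Function.Surjective φ := fun y => by
    obtain ⟨c, hc, hcy⟩ := restrict_surjOn_of_card_lt_dualDist C S hS y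
    exact ⟨⟨c, hc⟩, hcy⟩
  have hcomp : (S.restrict ∘ C.subtype : C → S → F) = φ := rfl
  rw [uniformOn_eq_map_subtype, PMF.map_comp, hcomp]
  exact map_uniformOfFintype_of_surjective φ hφ

end Literature.InformationTheory.Coding

end
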